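import Summits.HubbardSuperconductivity.HubbardSuperconductivity.Theorems.AnisotropyChordFourTorusKernelNeg

/-!
# Route `AnisotropyChord` / crux `ChordFM` at `M = 4` (`Δ ∈ [-1,0]`): kernel evaluation — the assembled matrix equals the literal,
# Δ = -1, rows `≥ 29` (prover seat `hubbard-h0-rotor-p1` g17; one `decide +kernel` per file)
-/

set_option linter.style.longLine false
set_option linter.dupNamespace false
set_option autoImplicit false

namespace Summit.HubbardSuperconductivity.HubbardSuperconductivity.Theorems.AnisotropyChord.FourTorus

/-- assembled = literal, Δ = -1, rows `≥ 29`. [folklore] -/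
theorem pAgreeN_m1_hi : pAgreeN 0 1 = true := by decide +kernel

end Summit.HubbardSuperconductivity.HubbardSuperconductivity.Theorems.AnisotropyChord.FourTorus
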